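import Summits.ValiantsHypothesis.ValiantsHypothesis.Theorems.DivisionGapDefs
import Summits.ValiantsHypothesis.ValiantsHypothesis.Theorems.DivisionGapPerDivisionHardStubTorus

/-!
# Crux `DivisionGap.PerDivisionHard` (stmt-ValiantsHypothesis-5065), line
`pair-descent-jss-endpoint` — stub `stub_torusFamily` (product-of-sparse-factors rung, wave 3):
the torus normal form of a PRODUCT, factor by factor

For a finite family `(q j)_{j ∈ J}` of nonzero cofactors in `ℝ≥0[x_ij]` (`n × n` matrix variables)
there is a family `(q' j)_{j ∈ J}` of nonzero TORUS-HOMOGENEOUS polynomials (`IsTorusHomogeneous`: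
all monomials of `q' j` share the row-margin vector and the column-margin vector), with
`supp (q' j) ⊆ supp (q j)` for every `j ∈ J`, such that replacing the product `∏ q j` by `∏ q' j`
costs nothing in either monotone complexity: `L(per_n · ∏ q' j) ≤ L(per_n · ∏ q j)` and
`L(∏ q' j) ≤ L(∏ q j)` (the tree's fan-in-two `complexity` over the semiring `ℝ≥0`).

This is the proof of `stub_torus` / `stub_torusSupport`
(`Theorems/DivisionGapPerDivisionHardStubTorus.lean`, `exists_topComponent_const_margins`) run
factorwise with a COMMON radix.  Row step: with `B := 1 + Σ_{j ∈ J} deg (q j)` (so every row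
margin of every monomial of every factor is a base-`B` digit) and the digit weight
`W_R : x_v ↦ B ^ (v.1)`, put `q₁ j := top_{W_R} (q j)`.  Top components are multiplicative over
`ℝ≥0` (`topComponent_mul`, hence `top (∏ q j) = ∏ q₁ j`, `topComponent_finset_prod`), the
permanent is `W_R`-homogeneous (`isWeightedHomogeneous_perPoly_digitWeight`), so
`top (per · ∏ q j) = per · ∏ q₁ j`, and initial forms are free (`complexity_topComponent_le`);
each `q₁ j` is nonzero with support inside that of `q j`, and all its monomials have the same
(maximal) `W_R`-weight, hence the same row margins (base-`B` uniqueness,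
`mapDomain_eq_of_mem_support_topComponent_radix` — the radix-generalised form of
`mapDomain_eq_of_mem_support_topComponent`).  Column step identically with `Prod.snd` and a fresh
common radix; supports only shrink, so the row margins stay constant.

Why it matters: together with `stub_sparseFamilyRigid` it proves `PerDivisionHard` for every
cofactor that is a PRODUCT of factors of quasi-polynomially bounded total support
(`perDivisionHard_sparseProduct`) — e.g. the cycle products `U_ℓ = ∏_{|C| ≤ ℓ} (x^{C⁺} + x^{C⁻})`,
the universal exchange cofactor `h_L` (`n^{O(log n)}` binomial factors), products of relabelled
small permanents — none of which is sparse as a polynomial and none of which any degree-based rung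
reaches. [folklore]
-/

noncomputable section

-- `Summit.ValiantsHypothesis.ValiantsHypothesis.…` is the tree's mandated single-conjunct layout
-- (Sub = Summit), so the duplicated namespace component is intended.
set_option linter.dupNamespace false

namespace Summit.ValiantsHypothesis.ValiantsHypothesis.Theorems.DivisionGapPerDivisionHard

open MvPolynomial Literature.Computability.AlgebraicComplexity
open Summit.ValiantsHypothesis.ValiantsHypothesis.Theorems.ZeroOneTransfer.Negative
open scoped NNReal

variable {n : ℕ}

/-! ### Top components of finite products -/

/-- **Top components are multiplicative over `ℝ≥0`, `Finset.prod` form**: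
`top_w (∏_{j ∈ s} f j) = ∏_{j ∈ s} top_w (f j)` (`topComponent_mul`, `topComponent_one`).
[folklore] -/
theorem topComponent_finset_prod {σ ι : Type*} (w : σ → ℕ) (s : Finset ι)
    (f : ι → MvPolynomial σ ℝ≥0) :
    topComponent w (∏ j ∈ s, f j) = ∏ j ∈ s, topComponent w (f j) :=
  Finset.prod_hom_rel (r := fun b c => topComponent w b = c) (topComponent_one w)
    fun a b c hbc => by rw [topComponent_mul, hbc]

/-! ### Digit weights with an arbitrary radix -/

/-- **All monomials of the top digit-weight component have the same `f`-margins, for ANY radix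
`B > deg p`** (radix-generalised `mapDomain_eq_of_mem_support_topComponent`): the `f`-margins of
a monomial of `p` are base-`B` digits (`≤ deg p < B`), the digit-weight of a monomial is the
base-`B` number with these digits (`weight_digitWeight`), and all monomials of the top component
have the same weight; base-`B` digit vectors are determined by their value
(`eq_of_sum_mul_pow_eq`). [folklore] -/
theorem mapDomain_eq_of_mem_support_topComponent_radix (f : Fin n × Fin n → Fin n) {B : ℕ}
    {p : MvPolynomial (Fin n × Fin n) ℝ≥0} (hB : p.totalDegree < B)
    {d d' : (Fin n × Fin n) →₀ ℕ}
    (hd : d ∈ (topComponent (fun v => B ^ ((f v : Fin n) : ℕ)) p).support)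
    (hd' : d' ∈ (topComponent (fun v => B ^ ((f v : Fin n) : ℕ)) p).support) :
    Finsupp.mapDomain f d = Finsupp.mapDomain f d' := by
  set W : Fin n × Fin n → ℕ := fun v => B ^ ((f v : Fin n) : ℕ)
  have hw : ∀ e ∈ (topComponent W p).support,
      Finsupp.weight W e = weightedTotalDegree W p := by
    intro e he
    have := mem_support_iff.mp he
    rw [coeff_topComponent] at this
    by_contra hne
    exact this (if_neg hne)
  have hlt : ∀ e ∈ (topComponent W p).support, ∀ i, Finsupp.mapDomain f e i < B :=
    fun e he i =>
      lt_of_le_of_lt (mapDomain_apply_le_totalDegree f (support_topComponent_subset _ p he) i) hB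
  exact DFunLike.coe_injective (eq_of_sum_mul_pow_eq (⇑(Finsupp.mapDomain f d))
    (⇑(Finsupp.mapDomain f d')) (hlt d hd) (hlt d' hd')
    (by rw [← weight_digitWeight, ← weight_digitWeight, hw d hd, hw d' hd']))

/-! ### One degeneration step for a family, with a common radix -/

/-- **One torus step, factorwise.**  For a finite family `(q j)_{j ∈ J}` of nonzero polynomials
and a map `f` enumerating `[n]` along every permutation monomial (rows `Prod.fst`, columns
`Prod.snd`), the top components `q' j := top_W (q j)` for the digit weight `W : x_v ↦ B^{f v}`
with the COMMON radix `B = 1 + Σ_{j ∈ J} deg (q j)` are nonzero, have supports inside those of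
the `q j`, have constant `f`-margins factor by factor, and cost nothing for the product:
`L(per · ∏ q' j) ≤ L(per · ∏ q j)` and `L(∏ q' j) ≤ L(∏ q j)` (`top (∏ q j) = ∏ q' j`,
`top per = per`, initial forms are free over `ℝ≥0`). [folklore] -/
theorem exists_family_topComponent_const_margins (f : Fin n × Fin n → Fin n)
    (hf : ∀ (B : ℕ) (π : Equiv.Perm (Fin n)),
      ∑ i : Fin n, B ^ ((f (π i, i) : Fin n) : ℕ) = ∑ a : Fin n, B ^ ((a : Fin n) : ℕ))
    {ι : Type*} (J : Finset ι) {q : ι → MvPolynomial (Fin n × Fin n) ℝ≥0}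
    (hq : ∀ j ∈ J, q j ≠ 0) :
    ∃ q' : ι → MvPolynomial (Fin n × Fin n) ℝ≥0, (∀ j ∈ J, q' j ≠ 0) ∧
      (∀ j ∈ J, (q' j).support ⊆ (q j).support) ∧
      (∀ j ∈ J, ∀ m ∈ (q' j).support, ∀ m' ∈ (q' j).support,
        Finsupp.mapDomain f m = Finsupp.mapDomain f m') ∧
      complexity (perPoly (Fin n) ℝ≥0 * ∏ j ∈ J, q' j) ≤
        complexity (perPoly (Fin n) ℝ≥0 * ∏ j ∈ J, q j) ∧
      complexity (∏ j ∈ J, q' j) ≤ complexity (∏ j ∈ J, q j) := by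
  set B := (∑ j ∈ J, (q j).totalDegree) + 1 with hB
  set W : Fin n × Fin n → ℕ := fun v => B ^ ((f v : Fin n) : ℕ)
  have hdeg : ∀ j ∈ J, (q j).totalDegree < B := fun j hj =>
    Nat.lt_succ_of_le
      (Finset.single_le_sum (f := fun j => (q j).totalDegree) (fun _ _ => Nat.zero_le _) hj)
  have hprod : topComponent W (∏ j ∈ J, q j) = ∏ j ∈ J, topComponent W (q j) :=
    topComponent_finset_prod W J q
  refine ⟨fun j => topComponent W (q j), fun j hj => topComponent_ne_zero W (hq j hj),
    fun j _ => support_topComponent_subset W (q j),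
    fun j hj m hm m' hm' => mapDomain_eq_of_mem_support_topComponent_radix f (hdeg j hj) hm hm',
    ?_, ?_⟩
  · have := complexity_topComponent_le W (perPoly (Fin n) ℝ≥0 * ∏ j ∈ J, q j)
    rwa [topComponent_mul, topComponent_eq_self_of_isWeightedHomogeneous W
      (isWeightedHomogeneous_perPoly_digitWeight f _ (hf _)), hprod] at this
  · have := complexity_topComponent_le W (∏ j ∈ J, q j)
    rwa [hprod] at this

/-! ### The stub -/

/-- **`stub_torusFamily` (product-of-sparse-factors rung of line `pair-descent-jss-endpoint` for
`PerDivisionHard`, wave 3).**  Every finite family `(q j)_{j ∈ J}` of nonzero cofactors in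
`ℝ≥0[x_ij]` may be replaced by a family `(q' j)_{j ∈ J}` of nonzero TORUS-HOMOGENEOUS polynomials
with `supp (q' j) ⊆ supp (q j)` (so monomial counts survive, factor by factor) at no cost for the
product in either monotone complexity: `L(per_n · ∏ q' j) ≤ L(per_n · ∏ q j)` and
`L(∏ q' j) ≤ L(∏ q j)`.  Two factorwise initial-form steps with common radices
(`exists_family_topComponent_const_margins` for `Prod.fst`, then for `Prod.snd`; supports only
shrink, so the row margins stay constant), reading the margins off one monomial per factor.
It feeds `perDivisionHard_sparseProduct`: `PerDivisionHard` for products of factors of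
quasi-polynomially bounded total support (cycle products `U_ℓ`, the universal exchange cofactor
`h_L`, products of relabelled small permanents), which are not sparse as polynomials. [folklore] -/
theorem stub_torusFamily :
    ∀ (n : ℕ) (ι : Type) (J : Finset ι) (q : ι → MvPolynomial (Fin n × Fin n) ℝ≥0),
      (∀ j ∈ J, q j ≠ 0) →
      ∃ q' : ι → MvPolynomial (Fin n × Fin n) ℝ≥0, (∀ j ∈ J, q' j ≠ 0) ∧
        (∀ j ∈ J, IsTorusHomogeneous (q' j)) ∧
        (∀ j ∈ J, (q' j).support ⊆ (q j).support) ∧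
        complexity (perPoly (Fin n) ℝ≥0 * ∏ j ∈ J, q' j) ≤
          complexity (perPoly (Fin n) ℝ≥0 * ∏ j ∈ J, q j) ∧
        complexity (∏ j ∈ J, q' j) ≤ complexity (∏ j ∈ J, q j) := by
  intro n ι J q hq
  -- row step: `per` is row-homogeneous since `i ↦ π i` is a bijection
  obtain ⟨q₁, hq₁, hsub₁, hrow, hle₁, hle₁'⟩ := exists_family_topComponent_const_margins Prod.fst
    (fun B π => Equiv.sum_comp π (fun a : Fin n => B ^ ((a : Fin n) : ℕ))) J hq
  -- column step: `per` is column-homogeneous trivially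
  obtain ⟨q₂, hq₂, hsub₂, hcol, hle₂, hle₂'⟩ :=
    exists_family_topComponent_const_margins Prod.snd (fun B π => rfl) J hq₁
  refine ⟨q₂, hq₂, fun j hj => ?_, fun j hj => (hsub₂ j hj).trans (hsub₁ j hj),
    hle₂.trans hle₁, hle₂'.trans hle₁'⟩
  obtain ⟨d₀, hd₀⟩ := exists_coeff_ne_zero (hq₂ j hj)
  have hd₀s : d₀ ∈ (q₂ j).support := mem_support_iff.mpr hd₀
  exact ⟨rowDegrees d₀, Finsupp.mapDomain Prod.snd d₀, fun m hm =>
    ⟨hrow j hj m (hsub₂ j hj hm) d₀ (hsub₂ j hj hd₀s), hcol j hj m hm d₀ hd₀s⟩⟩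

end Summit.ValiantsHypothesis.ValiantsHypothesis.Theorems.DivisionGapPerDivisionHard

end
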